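import Mathlib
import Summits.KontsevichZagierPeriods.KontsevichZagierPeriods.Theses.ComplexOrientations

/-!
# `OvalSector` (crux stmt-KontsevichZagierPeriods-11369), line `birth` — the interior of a circle

Route `KontsevichZagierPeriods/ComplexOrientations`, crux `OvalSector`. This file closes the plane
topology stub `stub_circleInterior` of the registered skeleton `Lines/birth.lean`: for a circle
`S = {(u₀ − a)² + (u₁ − b)² = c}` (`c > 0`) of the plane `Fin 2 → ℝ`, the points off `S` whose
connected component in `Sᶜ` is bounded (the route's `ovalInterior S`) are exactly the points of the
open disc `B = {(u₀ − a)² + (u₁ − b)² < c}`.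

Proof (pure plane topology, sup norm on `Fin 2 → ℝ`): `Sᶜ` is the disjoint union of the open sets
`B` and `E = {c < (u₀ − a)² + (u₁ − b)²}`. The component of a point of `B` is a preconnected subset
of `B ∪ E` meeting `B`, hence inside the bounded set `B`. The component of a point `v` of `E`
contains the ray `{v + t (v − (a, b)) : t ≥ 0}` (preconnected, inside `E ⊆ Sᶜ`), which is
unbounded.

References: J. Bochnak, M. Coste, M.-F. Roy, *Real Algebraic Geometry* (1998), §2.4 (folklore
plane topology).
-/

noncomputable section

open Set

namespace Summit.KontsevichZagierPeriods.ComplexOrientations.OvalSector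

/-- The open disc `{(w₀ − a)² + (w₁ − b)² < c}` of the plane `Fin 2 → ℝ` (sup norm) is bounded:
it lies in the closed ball of radius `√c` about `(a, b)`. [folklore] -/
private theorem isBounded_disc_circleInterior (a b c : ℝ) :
    Bornology.IsBounded {w : Fin 2 → ℝ | (w 0 - a) ^ 2 + (w 1 - b) ^ 2 < c} := by
  rw [isBounded_iff_forall_norm_le]
  refine ⟨√c + ‖(![a, b] : Fin 2 → ℝ)‖, fun w hw => ?_⟩
  rw [mem_setOf_eq] at hw
  have h1 : ‖w - ![a, b]‖ ≤ √c := by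
    refine (pi_norm_le_iff_of_nonneg (Real.sqrt_nonneg c)).2 (Fin.forall_fin_two.2 ⟨?_, ?_⟩)
    · rw [Pi.sub_apply, Matrix.cons_val_zero, Real.norm_eq_abs]
      exact Real.abs_le_sqrt (by nlinarith [sq_nonneg (w 1 - b)])
    · rw [Pi.sub_apply, Matrix.cons_val_one, Matrix.cons_val_fin_one, Real.norm_eq_abs]
      exact Real.abs_le_sqrt (by nlinarith [sq_nonneg (w 0 - a)])
  calc ‖w‖ = ‖(w - ![a, b]) + ![a, b]‖ := by rw [sub_add_cancel]
    _ ≤ ‖w - ![a, b]‖ + ‖(![a, b] : Fin 2 → ℝ)‖ := norm_add_le _ _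
    _ ≤ √c + ‖(![a, b] : Fin 2 → ℝ)‖ := by linarith

/-- The component in the complement of the circle `{(u₀ − a)² + (u₁ − b)² = c}` of a point of the
open disc `{(u₀ − a)² + (u₁ − b)² < c}` lies in the disc: it is a preconnected subset of the disjoint
union of the open disc and the open exterior meeting the disc. [folklore] -/
private theorem connectedComponentIn_subset_disc_circleInterior (a b c : ℝ) {v : Fin 2 → ℝ}
    (hv : (v 0 - a) ^ 2 + (v 1 - b) ^ 2 < c) :
    connectedComponentIn {u : Fin 2 → ℝ | (u 0 - a) ^ 2 + (u 1 - b) ^ 2 = c}ᶜ v ⊆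
      {u : Fin 2 → ℝ | (u 0 - a) ^ 2 + (u 1 - b) ^ 2 < c} := by
  have hf : Continuous fun u : Fin 2 → ℝ => (u 0 - a) ^ 2 + (u 1 - b) ^ 2 := by fun_prop
  have hBo : IsOpen {u : Fin 2 → ℝ | (u 0 - a) ^ 2 + (u 1 - b) ^ 2 < c} :=
    isOpen_lt hf continuous_const
  have hEo : IsOpen {u : Fin 2 → ℝ | c < (u 0 - a) ^ 2 + (u 1 - b) ^ 2} :=
    isOpen_lt continuous_const hf
  have hBE : Disjoint {u : Fin 2 → ℝ | (u 0 - a) ^ 2 + (u 1 - b) ^ 2 < c}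
      {u : Fin 2 → ℝ | c < (u 0 - a) ^ 2 + (u 1 - b) ^ 2} :=
    Set.disjoint_left.2 fun u (h₁ : _ < c) (h₂ : c < _) => lt_asymm h₁ h₂
  have hsub : connectedComponentIn {u : Fin 2 → ℝ | (u 0 - a) ^ 2 + (u 1 - b) ^ 2 = c}ᶜ v ⊆
      {u : Fin 2 → ℝ | (u 0 - a) ^ 2 + (u 1 - b) ^ 2 < c} ∪
        {u : Fin 2 → ℝ | c < (u 0 - a) ^ 2 + (u 1 - b) ^ 2} := fun u hu =>
    lt_or_gt_of_ne (connectedComponentIn_subset _ _ hu)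
  exact isPreconnected_connectedComponentIn.subset_left_of_subset_union hBo hEo hBE hsub
    ⟨v, mem_connectedComponentIn
      (show v ∈ {u : Fin 2 → ℝ | (u 0 - a) ^ 2 + (u 1 - b) ^ 2 = c}ᶜ from ne_of_lt hv), hv⟩

/-- The component in the complement of the circle `{(u₀ − a)² + (u₁ − b)² = c}` (`c > 0`) of a
point `v` of the open exterior `{c < (u₀ − a)² + (u₁ − b)²}` is unbounded: it contains the ray
`{v + t (v − (a, b)) : t ≥ 0}`. [folklore] -/
private theorem not_isBounded_connectedComponentIn_circleInterior (a b c : ℝ) (hc : 0 < c)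
    {v : Fin 2 → ℝ} (hv : c < (v 0 - a) ^ 2 + (v 1 - b) ^ 2) :
    ¬ Bornology.IsBounded
      (connectedComponentIn {u : Fin 2 → ℝ | (u 0 - a) ^ 2 + (u 1 - b) ^ 2 = c}ᶜ v) := by
  intro hK
  -- the ray `t ↦ v + t • (v − p)`, `t ≥ 0`, from `v` away from the centre `p = (a, b)`
  have hγS : (fun t : ℝ => v + t • (v - ![a, b])) '' Ici 0 ⊆
      {u : Fin 2 → ℝ | (u 0 - a) ^ 2 + (u 1 - b) ^ 2 = c}ᶜ := by
    rintro _ ⟨t, ht, rfl⟩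
    rw [mem_Ici] at ht
    rw [mem_compl_iff, mem_setOf_eq]
    have h01 : ((v + t • (v - ![a, b])) 0 - a) ^ 2 + ((v + t • (v - ![a, b])) 1 - b) ^ 2 =
        (1 + t) ^ 2 * ((v 0 - a) ^ 2 + (v 1 - b) ^ 2) := by
      simp only [Pi.add_apply, Pi.smul_apply, Pi.sub_apply, Matrix.cons_val_zero,
        Matrix.cons_val_one, Matrix.cons_val_fin_one, smul_eq_mul]
      ring
    rw [h01]
    have h2 : (1 : ℝ) ≤ (1 + t) ^ 2 := by nlinarith
    have h3 : c < (1 + t) ^ 2 * ((v 0 - a) ^ 2 + (v 1 - b) ^ 2) := by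
      nlinarith [mul_le_mul_of_nonneg_right h2 (hc.trans hv).le]
    exact h3.ne'
  have hγc : Continuous fun t : ℝ => v + t • (v - ![a, b]) := by fun_prop
  have hγK : (fun t : ℝ => v + t • (v - ![a, b])) '' Ici 0 ⊆
      connectedComponentIn {u : Fin 2 → ℝ | (u 0 - a) ^ 2 + (u 1 - b) ^ 2 = c}ᶜ v :=
    (isPreconnected_Ici.image _ hγc.continuousOn).subset_connectedComponentIn
      ⟨0, mem_Ici.2 le_rfl, by simp⟩ hγS
  obtain ⟨C, hC0, hC⟩ := (hK.subset hγK).exists_pos_norm_le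
  -- `v ≠ p`, since `v` lies outside the circle
  have hvp : v - ![a, b] ≠ 0 := by
    intro h
    have h0 : v 0 = a := by simpa [sub_eq_zero] using congr_fun h 0
    have h1 : v 1 = b := by simpa [sub_eq_zero] using congr_fun h 1
    rw [h0, h1, sub_self, sub_self] at hv
    norm_num at hv
    exact absurd hv (not_lt.2 hc.le)
  have hvp' : 0 < ‖v - ![a, b]‖ := norm_pos_iff.2 hvp
  -- the ray point at parameter `t = (C + ‖v‖ + 1) / ‖v − p‖` has norm `> C`
  set t : ℝ := (C + ‖v‖ + 1) / ‖v - ![a, b]‖ with ht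
  have ht0 : 0 ≤ t := div_nonneg (by linarith [norm_nonneg v]) (norm_nonneg _)
  have h1 : ‖v + t • (v - ![a, b])‖ ≤ C := hC _ (mem_image_of_mem _ (mem_Ici.2 ht0))
  have h2 : ‖t • (v - ![a, b])‖ = C + ‖v‖ + 1 := by
    rw [norm_smul, Real.norm_of_nonneg ht0, ht, div_mul_cancel₀ _ hvp'.ne']
  have h3 : ‖t • (v - ![a, b])‖ ≤ ‖v + t • (v - ![a, b])‖ + ‖v‖ := by
    calc ‖t • (v - ![a, b])‖ = ‖(v + t • (v - ![a, b])) - v‖ := by rw [add_sub_cancel_left]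
      _ ≤ ‖v + t • (v - ![a, b])‖ + ‖v‖ := norm_sub_le _ _
  linarith

/-- **Stub `stub_circleInterior`** (plane topology; the interior of a circle). For a circle
`S = {(u₀ − a)² + (u₁ − b)² = c}`, `c > 0`, the points off `S` whose connected component in the
complement of `S` is bounded are exactly the points of the open disc `{(u₀ − a)² + (u₁ − b)² < c}`:
the complement of `S` is the disjoint union of the open disc (bounded) and the open exterior, a
preconnected subset of the complement meeting the disc lies in the disc, and the component of an
exterior point contains an unbounded ray. [folklore] [cite: BochnakCosteRoy1998, §2.4] -/
theorem stub_circleInterior (a b c : ℝ) (hc : 0 < c) :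
    {v : Fin 2 → ℝ | v ∉ {u : Fin 2 → ℝ | (u 0 - a) ^ 2 + (u 1 - b) ^ 2 = c} ∧
      Bornology.IsBounded
        (connectedComponentIn {u : Fin 2 → ℝ | (u 0 - a) ^ 2 + (u 1 - b) ^ 2 = c}ᶜ v)} =
    {v : Fin 2 → ℝ | (v 0 - a) ^ 2 + (v 1 - b) ^ 2 < c} := by
  ext v
  simp only [mem_setOf_eq]
  constructor
  · rintro ⟨hvS, hK⟩
    rcases lt_or_gt_of_ne hvS with h | h
    · exact h
    · exact absurd hK (not_isBounded_connectedComponentIn_circleInterior a b c hc h)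
  · intro hv
    exact ⟨ne_of_lt hv, (isBounded_disc_circleInterior a b c).subset
      (connectedComponentIn_subset_disc_circleInterior a b c hv)⟩

end Summit.KontsevichZagierPeriods.ComplexOrientations.OvalSector

end
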